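import Summits.ResolutionOfSingularities.ResolutionOfSingularities.Theorems.FrobeniusLadderFRationalResolutionEtaleChartAffineOpen
import Summits.ResolutionOfSingularities.ResolutionOfSingularities.Theorems.FrobeniusLadderFRationalResolutionVeroneseEtale
import HarnessLib

/-!
# Crux `FrobeniusLadder.FRationalResolution` (stmt-ResolutionOfSingularities-15317), line `redirect`,
# stub `stub_diagonalizableQuotientResolution` — the stub for ISOLATED singularities with VERONESE-CONE étale charts

Capstone in the SHAPE OF THE STUB'S OWN HYPOTHESIS: the charts are étale MORPHISMS `φ : Spec k[χᵈ : |d| = r] ⟶ X` from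
the Veronese cone `V(n,r) = 𝔸ⁿ/μ_r` (= `Spec S₀` for `S = k[x₁,…,xₙ]` graded by `ℤ/r` with weights `(1,…,1)`), hitting
the singular point at the vertex. Combines `…EtaleChartAffineOpen.hasResolution_of_isolated_etale_pointBlowup_of_affineOpen`
(chart morphism ⇒ ring data ⇒ transfer of the point blow-up, no residue-field condition) with the cone programme's
`veroneseCone_isRegular_affineBlowup` (c5/g0: the vertex is resolved by ONE blow-up) and
`…VeroneseEtale.vertexIdeal_isMaximal`.

* `primeIdealOf_top_Spec` — on `Spec C`, the prime of a point `y` in `Γ(Spec C, ⊤)` is `y` transported along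
  `ΓSpecIso` (Mathlib `IsAffineOpen.primeIdealOf_eq_map_closedPoint`, `StructureSheaf.toStalk`);
* `isRegular_affineBlowup_primeIdealOf_top` — so a regular `Bl_y(Spec C)` gives the `V₀ = ⊤` datum of brick E';
* **`hasResolution_of_isolated_veronese_etale_charts`** — an integral `X` locally of finite type over ANY field `k`
  with finitely many singular points, each in the image of the VERTEX under an ÉTALE morphism from a Veronese cone
  `V(n,r)`, `n, r ≥ 2` (tame or wild, arbitrary residue fields), HAS A RESOLUTION OF SINGULARITIES.

Honest label: the endgame stub `stub_diagonalizableQuotientResolution` for isolated singularities and charts of weights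
`(1,…,1)` presented as the Veronese ring — a special case, not the stub (no stub closed by name). No definitions, no
named facts, no sorry. [folklore; cite: Kollar2007, §2.2]
-/

noncomputable section

-- single-problem summit: the doubled namespace component is forced
set_option linter.dupNamespace false

open CategoryTheory AlgebraicGeometry TopologicalSpace MvPolynomial
open Literature.AlgebraicGeometry.Resolution

namespace Summit.ResolutionOfSingularities.ResolutionOfSingularities.Theorems.FRationalResolution

/-- **The prime of a point of `Spec C` in `Γ(Spec C, ⊤)` is the point, transported along `ΓSpecIso`.** [folklore] -/
theorem primeIdealOf_top_Spec (C : Type) [CommRing C] (y : Spec (.of C)) :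
    ((isAffineOpen_top (Spec (.of C))).primeIdealOf ⟨y, trivial⟩).asIdeal =
      y.asIdeal.map (Scheme.ΓSpecIso (.of C)).inv.hom := by
  have hsurj : Function.Surjective (Scheme.ΓSpecIso (.of C)).inv.hom :=
    (Scheme.ΓSpecIso (.of C)).symm.commRingCatIsoToRingEquiv.surjective
  have hcomap : ((isAffineOpen_top (Spec (.of C))).primeIdealOf ⟨y, trivial⟩).asIdeal.comap
      (Scheme.ΓSpecIso (.of C)).inv.hom = y.asIdeal := by
    rw [IsAffineOpen.primeIdealOf_eq_map_closedPoint]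
    change Ideal.comap (Scheme.ΓSpecIso (.of C)).inv.hom
      (Ideal.comap ((Spec (.of C)).presheaf.germ ⊤ y trivial).hom
        (IsLocalRing.maximalIdeal ((Spec (.of C)).presheaf.stalk y))) = y.asIdeal
    rw [Ideal.comap_comap]
    have htoStalk : ((Spec (.of C)).presheaf.germ ⊤ y trivial).hom.comp (Scheme.ΓSpecIso (.of C)).inv.hom =
        (StructureSheaf.toStalk C y).hom := rfl
    rw [htoStalk]
    letI : Algebra C ((Spec (.of C)).presheaf.stalk y) := (StructureSheaf.toStalk C y).hom.toAlgebra
    haveI : IsLocalization.AtPrime ((Spec (.of C)).presheaf.stalk y) y.asIdeal :=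
      StructureSheaf.IsLocalization.to_stalk C y
    exact IsLocalization.AtPrime.under_maximalIdeal ((Spec (.of C)).presheaf.stalk y) y.asIdeal
  rw [← hcomap, Ideal.map_comap_of_surjective _ hsurj]

/-- **A regular `Bl_y(Spec C)` gives the `V₀ = ⊤` datum of brick E'.** [folklore] -/
theorem isRegular_affineBlowup_primeIdealOf_top (C : Type) [CommRing C] (y : Spec (.of C))
    (hreg : Scheme.IsRegular (affineBlowup y.asIdeal)) :
    Scheme.IsRegular (affineBlowup ((isAffineOpen_top (Spec (.of C))).primeIdealOf ⟨y, trivial⟩).asIdeal) := by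
  rw [primeIdealOf_top_Spec]
  haveI : IsOpenImmersion (Spec.map (CommRingCat.ofHom (Scheme.ΓSpecIso (.of C)).inv.hom)) := by
    rw [CommRingCat.ofHom_hom]; infer_instance
  exact BlowupFlatCriteria.isRegular_affineBlowup_map_of_isOpenImmersion _ _ hreg

section Cones

variable (k : Type) [Field k]

/-- The polynomial ring in `n` variables. -/
local notation3 "MP[" n "]" => MvPolynomial (Fin n) k

/-- The `r`-th Veronese subring of `k[x₁,…,xₙ]`: the `k`-subalgebra generated by the degree-`r` monomials. -/
local notation3 "VR[" n ", " r "]" =>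
  Algebra.adjoin k ((fun d : Fin n →₀ ℕ => MvPolynomial.monomial d (1 : k)) ''
    {d : Fin n →₀ ℕ | Finsupp.degree d = (r : ℕ)})

/-- The vertex ideal of the Veronese cone: spanned by the degree-`r` monomials. -/
local notation3 "VM[" n ", " r "]" =>
  Ideal.span {v : ↥VR[n, r] | ∃ d : Fin n →₀ ℕ, Finsupp.degree d = (r : ℕ) ∧
    (v : MvPolynomial (Fin n) k) = MvPolynomial.monomial d 1}

namespace VeroneseEtaleCharts

/-- **THE ENDGAME STUB FOR ISOLATED SINGULARITIES WITH VERONESE-CONE ÉTALE CHARTS (every dimension, every field,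
arbitrary residue fields).** Let `X` be an integral `k`-scheme locally of finite type with finitely many singular
points, each of which is `φ y` for an ÉTALE morphism `φ : V(n,r) = Spec k[χᵈ : |d| = r] → X` (`n, r ≥ 2`) and the
vertex `y` (the point containing all degree-`r` monomials). Then `X` has a resolution of singularities.
[cite: Kollar2007, §2.2] -/
theorem hasResolution_of_isolated_veronese_etale_charts (X : Scheme.{0}) [IsIntegral X]
    (f : X ⟶ Spec (.of k)) [LocallyOfFiniteType f] (hfin : (Scheme.regularLocus X)ᶜ.Finite)
    (hchart : ∀ x : X, x ∉ Scheme.regularLocus X →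
      ∃ (n r : ℕ) (_ : 2 ≤ n) (_ : 2 ≤ r) (φ : Spec (CommRingCat.of ↥VR[n, r]) ⟶ X) (_ : Etale φ)
        (y : Spec (CommRingCat.of ↥VR[n, r])), φ y = x ∧ VM[n, r] ≤ y.asIdeal) :
    Scheme.HasResolution X := by
  refine EtaleChartAffineOpen.hasResolution_of_isolated_etale_pointBlowup_of_affineOpen k X f hfin
    fun x hx => ?_
  obtain ⟨n, r, hn, hr, φ, hφ, y, hyx, hVM⟩ := hchart x hx
  have hr1 : 1 ≤ r := by omega
  -- the vertex: `y = VM`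
  have hy : y.asIdeal = VM[n, r] :=
    ((VeroneseEtale.vertexIdeal_isMaximal k n r hr1).eq_of_le y.isPrime.ne_top hVM).symm
  have hregy : Scheme.IsRegular (affineBlowup y.asIdeal) := by
    rw [hy]; exact veroneseCone_isRegular_affineBlowup k n r hr1
  exact ⟨Spec (CommRingCat.of ↥VR[n, r]), φ, hφ, y, hyx, ⊤, isAffineOpen_top _, trivial,
    isRegular_affineBlowup_primeIdealOf_top (↥VR[n, r]) y hregy⟩

end VeroneseEtaleCharts

end Cones

end Summit.ResolutionOfSingularities.ResolutionOfSingularities.Theorems.FRationalResolution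

end
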